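import Literature.AlgebraicGeometry.ShimuraVarieties.UnitaryShimuraCurveRecordMorphisms
import Literature.NumberTheory.Automorphic.UnitaryGroupFinAdelicCenter
import HarnessLib

/-!
# The rational centre acts trivially on the unitary Shimura CURVE: the Hecke translate by a rational norm-one scalar is `𝟙`

Topic `AlgebraicGeometry/ShimuraVarieties`; namespace `Literature.AlgebraicGeometry.ShimuraVarieties.UnitaryCanonicalModel`
(the home of ★ `RecordSystemGS`, `ShimuraSetGS`).  THEOREMS + one `def` with body (`rationalCenterGS`, the rational scalar
`x • 1₂ ∈ U(J⋆)(L⁺)`); no named fact, no instance, no `sorry`.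

For the record system ★ `RecordSystemGS` of the canonical model of `Sh(U(J⋆), 𝔻)` and a RATIONAL norm-one scalar
`x ∈ L` (`c(x)·x = 1`, i.e. a rational point of the centre `Z(U(J⋆)) = U(1)_{L/L⁺}`), read in `U(J⋆)(𝔸_{L⁺,f})` as the central
element `x · 1₂` (★ `UnitaryGroup.finAdelicCenter`):
* `ShimuraSetGS.mk_mul_finAdelicCenter_of_rational` — **`[v, a·(x·1₂) K] = [v, aK]` on `Sh_K(ℂ)`**: right translation by a rational
  central element is trivial on complex points (`x·1₂ ∈ U(J⋆)(L⁺)` acts on the negative vector `v` by the scalar `τ(x)`, absorbed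
  by `c := τ(x)⁻¹`; on the finite-adelic side it is central — [Milne2005ShimuraVarieties] §5 p. 57, Lemma 5.13);
* `RecordSystemGS.isHeckeTranslate_id_of_rational_central` — hence the identity of `M_K` IS the Hecke translate `T_{x·1₂}`;
* `RecordSystemGS.heckeTranslate_eq_id_of_rational_central` — and every such translate is `𝟙` (★ `heckeTranslate_unique`).
This is the clause «the centre `Z(ℚ)` acts trivially on `Sh_K`» behind the AUTOMORPHY of the central characters occurring in
`H¹_ét` of the curve tower ([Liu2021] proof of Thm. 4.15, l. 2199–2212: the see-saw sum runs over automorphic `χ₁`).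
HC_CM is not mentioned by this file.

## References
* [Milne2005ShimuraVarieties] J. S. Milne, *Introduction to Shimura varieties* (2005/2017): §5 p. 57, Lemma 5.13 p. 57,
  §13 p. 118 L21–28 (Thm. 13.6), Prop. 13.1 p. 117.
* [Liu2021] Y. Liu, Camb. J. Math. 9 (2021): proof of Thm. 4.15 (FJcycle.tex l. 2199–2212); Def. 4.11 (l. 2090, automorphic
  characters of `E¹\(𝔸_E^∞)¹`).
* [Mok2014] C. P. Mok, Mem. AMS 235 (2015), §1 Notation p. 5 (the centre `U_{E/F}(1)` of `U_{E/F}(N)`).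
-/

set_option autoImplicit false

noncomputable section

open Function MulAction Topology NumberField CategoryTheory Matrix AlgebraicGeometry IsDedekindDomain
open scoped Matrix ComplexOrder
open Literature.AlgebraicGeometry.Motives
open Literature.NumberTheory.Automorphic Literature.NumberTheory.Automorphic.UnitaryGroup
open Literature.NumberTheory.Automorphic.Liu2021.AppendixC (C5.OpenCompactSubgroup C5.SmallLevel)
open Literature.Geometry.ComplexHyperbolic Literature.Geometry.ComplexHyperbolic.BallModel

namespace Literature.AlgebraicGeometry.ShimuraVarieties.UnitaryCanonicalModel

variable {L : Type} [Field L] [NumberField L] [IsCMField L] {Jstar : Matrix (Fin 2) (Fin 2) L} {τ : L →+* ℂ}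
  {K₀ : C5.OpenCompactSubgroup ↥(finAdelic (↥(maximalRealSubfield L)) L (IsCMField.complexConj L) 2 Jstar)}

/-! ## §1. Rational norm-one scalars -/

omit [IsCMField L] in
/-- `L → 𝔸_{L,f}` is injective (read at one finite place). [folklore] -/
private theorem algebraMap_finiteAdeleRing_injective :
    Function.Injective (algebraMap L (FiniteAdeleRing (𝓞 L) L)) := by
  obtain ⟨P, hP⟩ := Ideal.exists_maximal (𝓞 L)
  let v : HeightOneSpectrum (𝓞 L) :=
    ⟨P, hP.isPrime, Ring.ne_bot_of_isMaximal_of_not_isField hP (RingOfIntegers.not_isField L)⟩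
  intro x y hxy
  have h := congrArg (fun z : FiniteAdeleRing (𝓞 L) L => z v) hxy
  simp only [FiniteAdeleRing.algebraMap_apply] at h
  exact (algebraMap L (v.adicCompletion L)).injective h

variable (L) in
/-- **A unit `x ∈ L` whose diagonal image is a norm-one finite idèle is itself of norm one: `c(x)·x = 1`** (the diagonal
`L → 𝔸_{L,f}` is injective and intertwines `c` with `c ⊗ 1`, ★ `algebraMap_galConj_finiteAdele`) — the rational points
`E¹ = U(1)(L⁺)` of the centre, in the form used by ★ `IsAutomorphicOneChar`. [cite: Liu2021, Def. 4.11 (l. 2090)] [cite: Mok2014, §1 Notation p. 5] -/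
theorem galConj_mul_self_eq_one_of_mem_finAdelicOne (x : Lˣ)
    (hx : Units.map (algebraMap L (FiniteAdeleRing (𝓞 L) L)).toMonoidHom x ∈
      finAdelicOne (↥(maximalRealSubfield L)) L (IsCMField.complexConj L)) :
    ((IsCMField.complexConj L : L ≃ₐ[↥(maximalRealSubfield L)] L) : L →+* L) (x : L) * x = 1 := by
  have h := (mem_finAdelicOne_iff (↥(maximalRealSubfield L)) L (IsCMField.complexConj L) _).1 hx
  change conjFiniteAdele (↥(maximalRealSubfield L)) L (IsCMField.complexConj L)
      (algebraMap L (FiniteAdeleRing (𝓞 L) L) x) * algebraMap L (FiniteAdeleRing (𝓞 L) L) x = 1 at h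
  rw [← algebraMap_galConj_finiteAdele, ← map_mul, ← map_one (algebraMap L (FiniteAdeleRing (𝓞 L) L))] at h
  exact algebraMap_finiteAdeleRing_injective h

variable (Jstar) in
/-- **The rational central element `x · 1₂ ∈ U(J⋆)(L⁺)`** of a norm-one scalar `x` (`c(x)·x = 1`; ★ `scalar_mem_unitaryGroupOfForm`):
a rational point of the centre `Z(U(J⋆)) = U(1)_{L/L⁺}`. [cite: Mok2014, §1 Notation p. 5] -/
def rationalCenterGS (x : Lˣ)
    (hx1 : ((IsCMField.complexConj L : L ≃ₐ[↥(maximalRealSubfield L)] L) : L →+* L) (x : L) * x = 1) :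
    ↥(rational (↥(maximalRealSubfield L)) L (IsCMField.complexConj L) 2 Jstar) :=
  ⟨Units.map (Matrix.scalar (Fin 2) : L →+* Matrix (Fin 2) (Fin 2) L).toMonoidHom x, scalar_mem_unitaryGroupOfForm _ _ _ hx1⟩

/-- underlying matrix of `x · 1₂`: the scalar (diagonal) matrix. [cite: Mok2014, §1 Notation p. 5] -/
theorem coe_rationalCenterGS (x : Lˣ)
    (hx1 : ((IsCMField.complexConj L : L ≃ₐ[↥(maximalRealSubfield L)] L) : L →+* L) (x : L) * x = 1) :
    (((rationalCenterGS Jstar x hx1 : ↥(rational (↥(maximalRealSubfield L)) L (IsCMField.complexConj L) 2 Jstar)) :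
        GL (Fin 2) L) : Matrix (Fin 2) (Fin 2) L) = Matrix.diagonal fun _ => (x : L) :=
  rfl

/-- **`x · 1₂` acts on `V⋆ ⊗_{L,τ} ℂ = ℂ²` by the scalar `τ(x)`**: `(x·1₂)^τ v = τ(x) • v`. [cite: Liu2021, Thm. 4.15 proof (FJcycle.tex l. 2193–2208)] -/
theorem ratToGLℂ_rationalCenterGS_mulVec (x : Lˣ)
    (hx1 : ((IsCMField.complexConj L : L ≃ₐ[↥(maximalRealSubfield L)] L) : L →+* L) (x : L) * x = 1) (v : Fin 2 → ℂ) :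
    ((ratToGLℂ L Jstar τ (rationalCenterGS Jstar x hx1) : GL (Fin 2) ℂ) : Matrix (Fin 2) (Fin 2) ℂ) *ᵥ v = τ x • v := by
  rw [coe_ratToGLℂ, coe_rationalCenterGS, Matrix.diagonal_map (map_zero τ)]
  funext i
  rw [Matrix.mulVec_diagonal, Pi.smul_apply, smul_eq_mul]

/-- **the diagonal image of `x · 1₂` in `U(J⋆)(𝔸_{L⁺,f})` IS the finite-adelic central element `x · 1₂`**
(★ `rationalToFinAdelic` vs ★ `finAdelicCenter`; both have underlying matrix `(x)_𝔸 · 1₂`). [cite: Mok2014, §1 Notation p. 5] -/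
theorem rationalToFinAdelic_rationalCenterGS (x : Lˣ)
    (hx : Units.map (algebraMap L (FiniteAdeleRing (𝓞 L) L)).toMonoidHom x ∈
      finAdelicOne (↥(maximalRealSubfield L)) L (IsCMField.complexConj L)) :
    rationalToFinAdelic (↥(maximalRealSubfield L)) L (IsCMField.complexConj L) 2 Jstar
        (rationalCenterGS Jstar x (galConj_mul_self_eq_one_of_mem_finAdelicOne L x hx)) =
      finAdelicCenter (↥(maximalRealSubfield L)) L (IsCMField.complexConj L) 2 Jstar ⟨_, hx⟩ := by
  refine Subtype.ext (Units.ext ?_)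
  rw [coe_rationalToFinAdelic, coe_finAdelicCenter, Matrix.smul_one_eq_diagonal]
  change ((((rationalCenterGS Jstar x (galConj_mul_self_eq_one_of_mem_finAdelicOne L x hx) :
      ↥(rational (↥(maximalRealSubfield L)) L (IsCMField.complexConj L) 2 Jstar)) : GL (Fin 2) L) :
        Matrix (Fin 2) (Fin 2) L).map (algebraMap L (FiniteAdeleRing (𝓞 L) L))) = _
  rw [coe_rationalCenterGS, Matrix.diagonal_map (map_zero _)]
  rfl

/-! ## §2. The rational centre acts trivially on `Sh_K(ℂ)` -/

/-- **`[v, a·(x·1₂) K] = [v, aK]` on `Sh_K(U(J⋆), 𝔻)(ℂ)`** for a rational norm-one scalar `x`: right translation by a RATIONAL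
CENTRAL element is trivial on complex points — witness `γ := x·1₂ ∈ U(J⋆)(L⁺)`, `c := τ(x)⁻¹` in ★ `ShimuraSetGS.mk_eq_mk_iff`
(`(x·1₂)^τ v = τ(x) v`; `x·1₂` central in `U(J⋆)(𝔸_f)`, ★ `finAdelicCenter_mul_comm`).  The clause «`Z(ℚ)` acts trivially on
`Sh_K(G,X)`» ([Milne2005ShimuraVarieties] §5 p. 57: `[x, a] = [γx, γak]`). [cite: Milne2005ShimuraVarieties, §5 p. 57 and Lemma 5.13 p. 57] -/
theorem ShimuraSetGS.mk_mul_finAdelicCenter_of_rational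
    (K : Subgroup ↥(finAdelic (↥(maximalRealSubfield L)) L (IsCMField.complexConj L) 2 Jstar))
    (v : Fin 2 → ℂ) (hv : v ∈ negCone (Jstar.map τ))
    (a : ↥(finAdelic (↥(maximalRealSubfield L)) L (IsCMField.complexConj L) 2 Jstar)) (x : Lˣ)
    (hx : Units.map (algebraMap L (FiniteAdeleRing (𝓞 L) L)).toMonoidHom x ∈
      finAdelicOne (↥(maximalRealSubfield L)) L (IsCMField.complexConj L)) :
    ShimuraSetGS.mk L Jstar τ K v hv
        (a * finAdelicCenter (↥(maximalRealSubfield L)) L (IsCMField.complexConj L) 2 Jstar ⟨_, hx⟩) =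
      ShimuraSetGS.mk L Jstar τ K v hv a := by
  have hx1 := galConj_mul_self_eq_one_of_mem_finAdelicOne L x hx
  have hτx : τ x ≠ 0 := (map_ne_zero τ).2 x.ne_zero
  rw [ShimuraSetGS.mk_eq_mk_iff]
  refine ⟨rationalCenterGS Jstar x hx1, (τ x)⁻¹, inv_ne_zero hτx, ?_, ?_⟩
  · rw [ratToGLℂ_rationalCenterGS_mulVec, smul_smul, inv_mul_cancel₀ hτx, one_smul]
  · rw [rationalToFinAdelic_rationalCenterGS x hx, Quotient.smul_coe, smul_eq_mul, finAdelicCenter_mul_comm]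

/-! ## §3. The Hecke translate by a rational central element is the identity of `M_K` -/

/-- **For a rational norm-one scalar `x`, the identity of `M_K` IS the Hecke translate `T_{x·1₂} : M_K ⟶ M_K`**
(`[v, a·(x·1₂)K] = [v, aK]`): the rational centre acts trivially on the canonical model — rank-2 companion of ★
`RecordSystemGS.isHeckeTranslate_id_of_mem` for the CENTRE instead of the level.
[cite: Milne2005ShimuraVarieties, §5 p. 57 and §13 p. 118 L21–26] -/
theorem RecordSystemGS.isHeckeTranslate_id_of_rational_central (S : RecordSystemGS L Jstar τ K₀) (K : C5.SmallLevel K₀)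
    (x : Lˣ)
    (hx : Units.map (algebraMap L (FiniteAdeleRing (𝓞 L) L)).toMonoidHom x ∈
      finAdelicOne (↥(maximalRealSubfield L)) L (IsCMField.complexConj L)) :
    S.IsHeckeTranslate K K (finAdelicCenter (↥(maximalRealSubfield L)) L (IsCMField.complexConj L) 2 Jstar ⟨_, hx⟩)
      (𝟙 (S.M.obj K)) := by
  letI : Algebra L ℂ := τ.toAlgebra
  intro v hv a
  rw [AlgPoints.map_id_apply, Homeomorph.apply_symm_apply, ShimuraSetGS.mk_mul_finAdelicCenter_of_rational K.1.1 v hv a x hx]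

/-- **Hence every Hecke translate `T_{x·1₂} : M_K ⟶ M_K` by a rational norm-one scalar is the identity** (★ `heckeTranslate_unique`):
the rational points of the centre `Z(U(J⋆)) = U(1)_{L/L⁺}` act trivially on the tower `{M_K}` — the clause that makes the central
characters occurring in the cohomology of the curve tower AUTOMORPHIC. [cite: Milne2005ShimuraVarieties, §5 p. 57 and Thm. 13.6 p. 118] [cite: Liu2021, proof of Thm. 4.15 (FJcycle.tex l. 2199–2212)] -/
theorem RecordSystemGS.heckeTranslate_eq_id_of_rational_central (S : RecordSystemGS L Jstar τ K₀) {K : C5.SmallLevel K₀}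
    (x : Lˣ)
    (hx : Units.map (algebraMap L (FiniteAdeleRing (𝓞 L) L)).toMonoidHom x ∈
      finAdelicOne (↥(maximalRealSubfield L)) L (IsCMField.complexConj L))
    {Tz : S.M.obj K ⟶ S.M.obj K}
    (h : S.IsHeckeTranslate K K (finAdelicCenter (↥(maximalRealSubfield L)) L (IsCMField.complexConj L) 2 Jstar ⟨_, hx⟩) Tz) :
    Tz = 𝟙 (S.M.obj K) :=
  S.heckeTranslate_unique h (S.isHeckeTranslate_id_of_rational_central K x hx)

/-- the level condition `z⁻¹ K z ≤ K` of a CENTRAL `z` holds at every level (`z⁻¹ k z = k`). [cite: Milne2005ShimuraVarieties, §13 p. 118 L21] -/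
theorem heckeLE_finAdelicCenter (K : C5.SmallLevel K₀)
    (u : ↥(finAdelicOne (↥(maximalRealSubfield L)) L (IsCMField.complexConj L))) :
    ∀ k ∈ K.1.1, (finAdelicCenter (↥(maximalRealSubfield L)) L (IsCMField.complexConj L) 2 Jstar u)⁻¹ * k *
      finAdelicCenter (↥(maximalRealSubfield L)) L (IsCMField.complexConj L) 2 Jstar u ∈ K.1.1 := by
  intro k hk
  rwa [mul_assoc, ← finAdelicCenter_mul_comm, ← mul_assoc, inv_mul_cancel, one_mul]

end Literature.AlgebraicGeometry.ShimuraVarieties.UnitaryCanonicalModel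

end
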